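import Summits.Ventures.WeilGRH.ZetaWindowAtomsLimit
import Summits.Ventures.WeilGRH.FlatWindowMeanDefect
import Summits.Ventures.WeilGRH.ZetaGramAtoms
import HarnessLib

/-!
# rh-explicit (venture WeilGRH): THE MEAN OVERSHOOT LAW AT EVERY HEIGHT — the one-window multiplicity
  certificate overshoots by an almost periodic function of the window whose MEAN is the second inverse
  spectral moment seen from `τ`

Cell `rh-explicit`, WEIL TRACK (structure seat weil-3, gen10).  Height-`τ` twin of gen9's
`FlatWindowMeanDefect.tendsto_average_defect` (there `τ = 0`, `χ`-form), for the `ζ` window form of the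
modulated flat window `u_{a,τ} = e^{−iτx}χ_0` of `ZetaWindowAtomsLimit.lean`.  For a positive measure `μ`
representing Weil's form, the OVERSHOOT of the certificate `W_a(u_{a,τ}) ≥ 2a·μ{τ}` is, after multiplying
by `a`, the Fejér integral WITHOUT the atom:

* `mul_weilWindowForm_modulated_sub_eq_integral` (one window): `a·W_a(u_{a,τ}) − 2a²·μ{τ} = ∫ 2sin²(a(t−τ))/(t−τ)² dμ(t)`;
* **`tendsto_average_overshoot`** (all windows, RH-free; `(t−τ)⁻² ∈ L¹(μ)`):
  `(1/A)∫₀^A [a·W_a(u_{a,τ}) − 2a²·μ{τ}] da → ∫ (t−τ)⁻² dμ(t)` as `A → ∞`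
  — with the RATE `W_a/(2a) − μ{τ} ≤ a⁻²∫(t−τ)⁻²dμ` of `ZetaWindowAtomsLimit` this says the rate is attained
  ON AVERAGE up to the factor `½`: sharp to order `a⁻²` and to no better order;
* under RH (`μ = ν_ζ`): **`tendsto_average_overshoot_of_riemannHypothesis`**:
  `(1/A)∫₀^A a·[W_a(e^{−iγx}χ_0) − 2a·ord_{s=½+iγ}ζ] da → Σ_{ρ' : γ' ≠ γ} m_{ρ'}/(γ'−γ)²` for every real `γ`.

No definitions, no named facts; RH only where named.
-/

set_option autoImplicit false

noncomputable section

open Complex Filter Set MeasureTheory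
open scoped Real Topology ComplexConjugate

namespace Summit.Ventures.WeilGRH

open Literature.NumberTheory.LFunctions
open Literature.NumberTheory.LFunctions.Yoshida1992 (chi)
open Literature.NumberTheory.LFunctions.WeilBochner (zetaZeroHeightMeasure)
open Summit.RiemannHypothesis.RiemannHypothesis.Theorems.WeilFormatC
open Summit.RiemannHypothesis.RiemannHypothesis.Theorems.WeilBochnerMeasure (integrable_inv_one_add_sq)

variable {a : ℝ}

/-! ## One window: the overshoot is the Fejér integral without the atom -/

/-- `‖û_{a,τ}(½+it)‖² = 2a·𝟙_{τ}(t) + 2sin²(a(t−τ))/(a(t−τ)²)` EXACTLY (`0⁻¹ = 0` at `t = τ`). -/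
theorem norm_sq_weilMellin_modulated_eq_indicator_add (ha : 0 < a) (τ t : ℝ) :
    ‖weilMellin (fun x ↦ cexp (I * ((-τ) * x : ℝ)) * chi a 0 x) (1 / 2 + t * I)‖ ^ 2 =
      ({τ} : Set ℝ).indicator (fun _ ↦ 2 * a) t + 2 * Real.sin (a * (t - τ)) ^ 2 / (a * (t - τ) ^ 2) := by
  rw [weilMellin_modulated_chi_zero, norm_sq_weilMellin_chi_zero_eq_indicator_add ha, ← sub_eq_add_neg]
  congr 1
  by_cases ht : t = τ
  · subst ht; simp
  · rw [indicator_of_notMem (by simpa [sub_eq_zero] using ht), indicator_of_notMem (by simpa using ht)]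

/-- **The overshoot of one window, times `a`, is the Fejér integral without the atom**: for `a > 0`, every
positive `μ` representing Weil's form on the tests of `[-a, a]` and every `τ`:
`a·weilWindowForm a (e^{−iτx}χ_0) − 2a²·μ{τ} = ∫ 2sin²(a(t−τ))/(t−τ)² dμ(t)`, the integrand `μ`-integrable. -/
theorem mul_weilWindowForm_modulated_sub_eq_integral (ha : 0 < a) {μ : Measure ℝ}
    (hμ : ∀ g : ℝ → ℂ, IsWeilTest g → tsupport g ⊆ Icc (-a) a →
      Integrable (fun t : ℝ ↦ ‖weilMellin g (1 / 2 + t * I)‖ ^ 2) μ ∧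
        weilQuadratic g = ((∫ t, ‖weilMellin g (1 / 2 + t * I)‖ ^ 2 ∂μ : ℝ) : ℂ)) (τ : ℝ) :
    Integrable (fun t : ℝ ↦ 2 * Real.sin (a * (t - τ)) ^ 2 / (t - τ) ^ 2) μ ∧
      a * weilWindowForm a (fun x ↦ cexp (I * ((-τ) * x : ℝ)) * chi a 0 x) - 2 * a ^ 2 * μ.real {τ} =
        ∫ t, 2 * Real.sin (a * (t - τ)) ^ 2 / (t - τ) ^ 2 ∂μ := by
  obtain ⟨hint, heq⟩ := weilWindowForm_modulated_eq_integral ha hμ τ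
  have h0 := measure_singleton_lt_top_of_integrable (integrable_inv_one_add_sq ha hμ) τ
  have hind : Integrable (fun t : ℝ ↦ ({τ} : Set ℝ).indicator (fun _ ↦ 2 * a) t) μ :=
    (integrable_indicator_iff (measurableSet_singleton τ)).2 (integrableOn_const h0.ne)
  simp_rw [norm_sq_weilMellin_modulated_eq_indicator_add ha τ] at hint heq
  -- the Fejér part is integrable as the difference
  have hF : Integrable (fun t : ℝ ↦ 2 * Real.sin (a * (t - τ)) ^ 2 / (a * (t - τ) ^ 2)) μ := by
    have := hint.sub hind
    refine this.congr (Eventually.of_forall fun t ↦ ?_)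
    simp only [Pi.sub_apply, add_sub_cancel_left]
  have hF' : Integrable (fun t : ℝ ↦ 2 * Real.sin (a * (t - τ)) ^ 2 / (t - τ) ^ 2) μ := by
    refine (hF.const_mul a).congr (Eventually.of_forall fun t ↦ ?_)
    show a * (2 * Real.sin (a * (t - τ)) ^ 2 / (a * (t - τ) ^ 2)) = 2 * Real.sin (a * (t - τ)) ^ 2 / (t - τ) ^ 2
    rcases eq_or_ne t τ with rfl | ht
    · simp
    · have : (t - τ) ^ 2 ≠ 0 := by positivity
      field_simp
  refine ⟨hF', ?_⟩
  rw [heq, integral_add hind hF, integral_indicator_const _ (measurableSet_singleton τ), smul_eq_mul]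
  have e : a * ∫ t, 2 * Real.sin (a * (t - τ)) ^ 2 / (a * (t - τ) ^ 2) ∂μ =
      ∫ t, 2 * Real.sin (a * (t - τ)) ^ 2 / (t - τ) ^ 2 ∂μ := by
    rw [← integral_const_mul]
    refine integral_congr_ae (Eventually.of_forall fun t ↦ ?_)
    show a * (2 * Real.sin (a * (t - τ)) ^ 2 / (a * (t - τ) ^ 2)) = 2 * Real.sin (a * (t - τ)) ^ 2 / (t - τ) ^ 2
    rcases eq_or_ne t τ with rfl | ht
    · simp
    · have : (t - τ) ^ 2 ≠ 0 := by positivity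
      field_simp
  rw [mul_add, e]
  ring

/-! ## All windows: the mean overshoot is the second inverse moment seen from `τ` -/

/-- Fubini for the shifted Fejér integrand (domination by `2(t−τ)⁻²`). -/
theorem intervalIntegral_integral_fejer_shift_swap {μ : Measure ℝ} [SFinite μ] (τ : ℝ)
    (hM : Integrable (fun t : ℝ ↦ ((t - τ) ^ 2)⁻¹) μ) {A : ℝ} (hA : 0 ≤ A) :
    ∫ a in (0 : ℝ)..A, (∫ t, 2 * Real.sin (a * (t - τ)) ^ 2 / (t - τ) ^ 2 ∂μ) =
      ∫ t, (∫ a in (0 : ℝ)..A, 2 * Real.sin (a * (t - τ)) ^ 2 / (t - τ) ^ 2) ∂μ := by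
  refine intervalIntegral_integral_swap ?_
  rw [Set.uIoc_of_le hA]
  have hfin : volume (Ioc (0 : ℝ) A) ≠ ⊤ := by rw [Real.volume_Ioc]; exact ENNReal.ofReal_ne_top
  have h1 : Integrable (fun _ : ℝ ↦ (1 : ℝ)) (volume.restrict (Ioc 0 A)) :=
    integrableOn_const (C := (1 : ℝ)) hfin
  have hdom : Integrable (fun p : ℝ × ℝ ↦ (1 : ℝ) * (2 * ((p.2 - τ) ^ 2)⁻¹)) ((volume.restrict (Ioc 0 A)).prod μ) :=
    h1.mul_prod (hM.const_mul 2)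
  refine hdom.mono' ?_ (ae_of_all _ fun p ↦ ?_)
  · exact (by fun_prop : Measurable fun p : ℝ × ℝ ↦
      2 * Real.sin (p.1 * (p.2 - τ)) ^ 2 / (p.2 - τ) ^ 2).aestronglyMeasurable
  · show ‖2 * Real.sin (p.1 * (p.2 - τ)) ^ 2 / (p.2 - τ) ^ 2‖ ≤ 1 * (2 * ((p.2 - τ) ^ 2)⁻¹)
    rw [Real.norm_of_nonneg (by positivity), one_mul, div_eq_mul_inv]
    exact mul_le_mul_of_nonneg_right (by nlinarith [Real.sin_sq_le_one (p.1 * (p.2 - τ))]) (by positivity)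

/-- The averaged kernel tends to the shifted second inverse moment:
`∫ (t−τ)⁻²(1 − sin(2A(t−τ))/(2A(t−τ))) dμ → ∫ (t−τ)⁻² dμ` (push-forward to `FlatWindowMeanDefect.tendsto_integral_average_fejer`). -/
theorem tendsto_integral_average_fejer_shift {μ : Measure ℝ} (τ : ℝ)
    (hM : Integrable (fun t : ℝ ↦ ((t - τ) ^ 2)⁻¹) μ) :
    Tendsto (fun A : ℝ ↦ ∫ t, ((t - τ) ^ 2)⁻¹ * (1 - Real.sin (2 * A * (t - τ)) / (2 * A * (t - τ))) ∂μ) atTop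
      (𝓝 (∫ t, ((t - τ) ^ 2)⁻¹ ∂μ)) := by
  set ν : Measure ℝ := μ.map (fun t ↦ t - τ) with hν
  have hφ : AEMeasurable (fun t : ℝ ↦ t - τ) μ := (measurable_sub_const τ).aemeasurable
  have hmap : ∀ {f : ℝ → ℝ}, Measurable f → ∫ s, f s ∂ν = ∫ t, f (t - τ) ∂μ := fun {f} hf ↦ by
    rw [hν, integral_map hφ hf.aestronglyMeasurable]
  have hmeas1 : Measurable fun s : ℝ ↦ (s ^ 2)⁻¹ := (measurable_id.pow_const 2).inv
  have hmeas2 : ∀ A : ℝ, Measurable fun s : ℝ ↦ (s ^ 2)⁻¹ * (1 - Real.sin (2 * A * s) / (2 * A * s)) :=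
    fun A ↦ by fun_prop
  have hMν : Integrable (fun s : ℝ ↦ (s ^ 2)⁻¹) ν := by
    rw [hν, integrable_map_measure hmeas1.aestronglyMeasurable hφ]
    exact hM
  have h := tendsto_integral_average_fejer hMν
  rw [hmap hmeas1] at h
  refine h.congr fun A ↦ ?_
  exact hmap (hmeas2 A)

/-- **THE MEAN OVERSHOOT LAW AT EVERY HEIGHT.**  Let `μ` be a positive measure representing Weil's form on
all tests, `τ ∈ ℝ`, with `(t−τ)⁻² ∈ L¹(μ)` (the atom at `τ` not counted).  Then

  `(1/A) ∫₀^A [a·weilWindowForm a (e^{−iτx}χ_0) − 2a²·μ{τ}] da → ∫ (t−τ)⁻² dμ(t)`   (`A → ∞`):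

the overshoot `a·[W_a(u_{a,τ}) − 2a·μ{τ}] = ∫2sin²(a(t−τ))/(t−τ)²dμ ∈ [0, 2∫(t−τ)⁻²dμ]` is an almost periodic
function of the window whose MEAN is exactly the second inverse moment of the rest of the spectral measure
seen from `τ` — the rate `a⁻²` of `ZetaWindowAtomsLimit` is attained on average (to the factor `½`). -/
theorem tendsto_average_overshoot {μ : Measure ℝ}
    (hμ : ∀ g : ℝ → ℂ, IsWeilTest g →
      Integrable (fun t : ℝ ↦ ‖weilMellin g (1 / 2 + t * I)‖ ^ 2) μ ∧
        weilQuadratic g = ((∫ t, ‖weilMellin g (1 / 2 + t * I)‖ ^ 2 ∂μ : ℝ) : ℂ)) (τ : ℝ)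
    (hM : Integrable (fun t : ℝ ↦ ((t - τ) ^ 2)⁻¹) μ) :
    Tendsto (fun A : ℝ ↦ 1 / A * ∫ a in (0 : ℝ)..A,
        (a * weilWindowForm a (fun x ↦ cexp (I * ((-τ) * x : ℝ)) * chi a 0 x) - 2 * a ^ 2 * μ.real {τ}))
      atTop (𝓝 (∫ t, ((t - τ) ^ 2)⁻¹ ∂μ)) := by
  have hI : Integrable (fun t : ℝ ↦ (1 + t ^ 2)⁻¹) μ := integrable_inv_one_add_sq one_pos (fun g hg _ ↦ hμ g hg)
  haveI : SigmaFinite μ := sigmaFinite_of_integrable_inv_one_add_sq hI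
  have hptw : ∀ a : ℝ, 0 ≤ a →
      a * weilWindowForm a (fun x ↦ cexp (I * ((-τ) * x : ℝ)) * chi a 0 x) - 2 * a ^ 2 * μ.real {τ} =
        ∫ t, 2 * Real.sin (a * (t - τ)) ^ 2 / (t - τ) ^ 2 ∂μ := by
    intro a ha0
    rcases ha0.eq_or_lt with rfl | ha
    · simp
    · exact (mul_weilWindowForm_modulated_sub_eq_integral ha (fun g hg _ ↦ hμ g hg) τ).2
  have hev : ∀ᶠ A in atTop, ∫ t, ((t - τ) ^ 2)⁻¹ * (1 - Real.sin (2 * A * (t - τ)) / (2 * A * (t - τ))) ∂μ =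
      1 / A * ∫ a in (0 : ℝ)..A,
        (a * weilWindowForm a (fun x ↦ cexp (I * ((-τ) * x : ℝ)) * chi a 0 x) - 2 * a ^ 2 * μ.real {τ}) := by
    filter_upwards [eventually_gt_atTop (0 : ℝ)] with A hA
    rw [intervalIntegral.integral_congr (g := fun a ↦ ∫ t, 2 * Real.sin (a * (t - τ)) ^ 2 / (t - τ) ^ 2 ∂μ)
      (fun a ha ↦ hptw a (by rw [Set.uIcc_of_le hA.le] at ha; exact ha.1)),
      intervalIntegral_integral_fejer_shift_swap τ hM hA.le, ← integral_const_mul]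
    refine integral_congr_ae (Eventually.of_forall fun t ↦ ?_)
    exact (average_fejer_eq hA (t - τ)).symm
  exact (tendsto_integral_average_fejer_shift τ hM).congr' hev

/-! ## Under RH -/

/-- **RH ⟹ THE MEAN OVERSHOOT LAW AT EVERY HEIGHT**: for every real `γ`,
`(1/A)∫₀^A a·[weilWindowForm a (e^{−iγx}χ_0) − 2a·ord_{s=½+iγ}ζ(s)] da → Σ_{ρ' : γ' ≠ γ} m_{ρ'}/(γ'−γ)²`
(the sum written as `∫((t−γ)²)⁻¹dν_ζ`, finite unconditionally — `ZetaWindowAtomsRH.integrable_inv_sq_sub_zetaZeroHeightMeasure`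
gives it; here it is a hypothesis to keep this file independent of that one). -/
theorem tendsto_average_overshoot_of_riemannHypothesis (hRH : RiemannHypothesis) (γ : ℝ)
    (hM : Integrable (fun t : ℝ ↦ ((t - γ) ^ 2)⁻¹) zetaZeroHeightMeasure) :
    Tendsto (fun A : ℝ ↦ 1 / A * ∫ a in (0 : ℝ)..A,
        (a * weilWindowForm a (fun x ↦ cexp (I * ((-γ) * x : ℝ)) * chi a 0 x) -
          2 * a ^ 2 * ((riemannZetaZeroOrder (1 / 2 + γ * I)).toNat : ℝ)))
      atTop (𝓝 (∫ t, ((t - γ) ^ 2)⁻¹ ∂zetaZeroHeightMeasure)) := by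
  have h := tendsto_average_overshoot
    (fun _ hg ↦ WeilBochner.weilQuadratic_eq_integral_of_riemannHypothesis hRH hg) γ hM
  rwa [measureReal_def, zetaZeroHeightMeasure_singleton_of_riemannHypothesis hRH, ENNReal.toReal_natCast] at h

end Summit.Ventures.WeilGRH

end
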